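import Summits.QuantumFields.BalabanUV.T4Continuum.Support.B13StepEnvelopeEndSubstrateShiftBalaban
import Summits.QuantumFields.BalabanUV.T4Continuum.Support.B13StepEnvelopeEndUniform

/-!
# B13StepEnvelopeEndSubstrateShiftBalabanUniform — NE5 ∕ U3: the η-UNIFORM companion (`∃ C₅` OUTERMOST) of `B13StepEnvelopeEndSubstrateShiftBalaban`:
# E9[rec,sub] AT THE SUBSTRATE's COV-SHIFTED O1 INSTANCE `slotsOfRecordShift …` ∕ `measOp …` WITH W1 PRODUCED AT BAŁABAN's TIER-B BACKGROUND (W-21b) —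
# ONE constant for EVERY driven two-run object and EVERY letter package

Cell `pub-balaban`, unit `b2b-balaban-t4-ne5-formalise-leaf-03` (NE5 formalisation swarm, LEAF PROVER 03, gen 16; the second half of the module pair announced
in the journal INTENT `HOME/CLAIMS.log` l.20304, split for the 400-line rule exactly as the gen-13 pair p229393 ∕ p229697).  THE RE-POINTED TWIN of this
lineage's gen-13 `B13StepEnvelopeEndSubstrateBalabanUniform` (p229697): `slotsOfRecord ↦ slotsOfRecordShift` (substrate-p1's W-21, run B's covariance slot
ONE LEVEL DEEPER, NE5 owner R53 ∕ R54), W1 := W-21b `SubstrateO1ReadingsShift.weightedEntrywiseRate_slotsOfRecordShift_balaban_ne3Shape` with WINDOWED tower readings `ReadsTowerCovAOn {k : ℕ | k ≤ D.K}` ∕ `ReadsTowerCovBOn …` (owner R55 (R-i), g37-c `B13ReadingsLevelWindow`)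
(R55), which LIFTS the docstring-level vacuity flag F-ne5p1-g37-1 carried by p229697's displayed pair `ReadsTowerCovA … ∧ ReadsTowerCovB …` at the unshifted
slots.  Imports `B13StepEnvelopeEndSubstrateShiftBalaban` (and through it this lineage's `B13StepEnvelopeEndSubstrateShift`, leaf-10's `B13StepEndInsOpBalaban`
p225077 §1, substrate-p1's W-21 ∕ W-21b and the letter lemmas at the shift) and this lineage's `B13StepEnvelopeEndUniform` (p218872) ONLY; edits nothing;
defines NO species reading (R41) and constructs ∕ discharges NOTHING of the instance (R34).  Summits-side new work under the LEAN PLACEMENT RULE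
(bookkeeping; 0 `def`, 0 cite tags — printed KIND only).
HONEST FRAMING: rung (B)+1 of the FINITE-VOLUME T⁴ continuum programme — NOT infinite volume, NOT a mass gap, NOT the Clay problem, and **NOT A PROOF OF
NE5** (NOT PRINTED: the series prints ε-UNIFORM bounds, never η-RATES; cell GAPS G-t4-U3-1), NOT a proof of NE2 or NE3: the theorem is an IMPLICATION whose
wall binders — W2-op `ActOpLineAnalyticOn` of the cores OF THE INSTANCE through `↥measOp → OpDatum` (GAPS G-ne5p1-1′∕1″, NOT PRINTED), the activity-norm
majorant with decay split and anchored norm, U1b's `NE3Shape` (row NE3, OPEN) with the (3.35)-class ∕ threshold letters, the owner's O1 letters at the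
substrate's shifted tables, W4, the W3 slice budgets, L05∕L06, the substrate's six LETTER conditions and factorisation datum, the numerics — are DISPLAYED
HYPOTHESES asserted nowhere.  W1-cov of record at the shifted slots = rows NE2 ∧ NE3's TWO-LEVEL tower rate (R53 (3)), asserted by nobody here.  R48 ∕ R49
HONEST LINE: the slots are the VALUE-TABLE model (poorer than print at MI-R, [Balaban1988RG2Cluster] Lemma 1 (1.33)); Road D is of record for MI-R; VALUE
UNCHANGED.  HONEST DEPENDENCY (cell line, verbatim): continuum YM on T⁴ ⇐ BetaPertH ∧ nine spine estimates (0/9 proved); BetaPertH ⇐ (D1) ∧ (D4) ∧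
CAP+tail; G-an2-4 gates asym, D1 and NE2/3/4.

WHAT THIS FILE DOES (one composition BY NAME; no analytic estimate of its own): **`uniform_ne5_of_substrateShift_restrict_envelope_balaban_ne3Shape`** —
this lineage's `B13StepEnvelopeEndUniform.uniform_ne5_of_record_restrict_envelope` (entry type quantified INSIDE `∃ C₅`, so the species index type
`SpeciesRec D …` varies with `D`) at `c₁ :=` W1's assembled constant `√(2B₁(2·CpertRec∕(1 − max θ L⁻¹))) + √(2B₂Λ₂CpertRec) + √(2B₃Λ₃CpertRec) + Λ₄C +
Λ₅C` and `θ := √(max θ L⁻¹)` (both SIZES; `0 < √(max θ L⁻¹) < 1` from U1b's `θ < 1` by `sqrt_rate_pos_lt_one`, `0 ≤ c₁` by `c1_balaban_nonneg`): the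
SIZES (`κ Φ′ EA₀ E₀ cA cB r₀ δ′ θ′ ω` + W1's constant letters `o d L a α β C a′ B₁ B₂ B₃ Λ₂ … Λ₅` + `θ < 1`) fixed OUTSIDE, then `∃ C₅, ∀ 𝔾 D oc ιr cc ag sg
T ι′ Sy Ω 𝒴 Pm IOp 𝒵 domZ Jc Vv mI Lsl (six letter conditions at the shift) iopAt 𝒞 N dom RgV tow W … Ω′ ROp RHist A A′ Dt`, with `Lsl.ins.ω = ω`, `hiopA`,
`hreg`, `hNE3`, the O1 letters and E9's per-object binders INSIDE — per object, `hwer :=` W-21b's `weightedEntrywiseRate_slotsOfRecordShift_balaban_ne3Shape`,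
`M := measOp …` with `hMA ∕ hMB := opA ∕ opB_mem_measOp_slotsOfRecordShift …`, `hT := transportReads_slotsOfRecordShift_of_factor …`.  Conclusion LITERALLY
`T4OutputRate.NE5 (B13StepOfRecord.outA (slotsOfRecordShift …) E₀ cB) (B13StepOfRecord.outB (slotsOfRecordShift …) E₀ cB) W κ θ′ C₅`.  CENSUS vs p229697 §2
(binders, by name): IDENTICAL outer and inner lists; the ONLY changes are the instance (`slotsOfRecord ↦ slotsOfRecordShift`), run B's raw record
(`rawBOfRecord ιr D … ↦ rawBOfRecordShift D ιr …` in `hbdB` and in the run-B readings) and the SHAPE of the two tower readings (WINDOWED tower readings `ReadsTowerCovAOn {k : ℕ | k ≤ D.K}` ∕ `ReadsTowerCovBOn …` (owner R55 (R-i), g37-c `B13ReadingsLevelWindow`)).  Headline wording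
(trigger c5 ∕ referee INFO-38): «END ⇐ instance letters», never «leaf instantiated»; 0∕12 leaves on Bałaban's concrete objects (O1 = substrate cell);
spine 0∕9.  `FlowStep.BetaPertH`, (B), (B^μ) do not occur.  0 sorry; axioms ⊆ {propext, Classical.choice, Quot.sound}.
-/

noncomputable section

open scoped BigOperators Matrix.Norms.L2Operator
open Metric Set

namespace Summit.QuantumFields.BalabanUV.T4Continuum.B13StepEnvelopeEndSubstrateShiftBalabanUniform

open _root_.MeasureTheory
open Literature.MathematicalPhysics.QuantumFieldTheory.Balaban1983to89
open Literature.MathematicalPhysics.QuantumFieldTheory.Balaban1983to89.T4OutputRate (DecayBound NE5)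
open Literature.MathematicalPhysics.QuantumFieldTheory.Balaban1983to89.T4InputCauchyRateSpecies (ballClass)
open Literature.MathematicalPhysics.QuantumFieldTheory.Balaban1983to89.B5Prop11Plancherel (Cst Tor fine)
open Literature.MathematicalPhysics.QuantumFieldTheory.Balaban1983to89.B5G183RateUnitTower (lev lev_neZero)
open Literature.MathematicalPhysics.QuantumFieldTheory.Balaban1983to89.T4EtaRateMin (NE3Shape)
open Summit.QuantumFields.BalabanUV.T4Continuum
open Summit.QuantumFields.BalabanUV.T4Continuum.B13Carriers (TwoRuns)
open Summit.QuantumFields.BalabanUV.T4Continuum.B13OpDatum (OpDatum Species FormatBounded)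
open Summit.QuantumFields.BalabanUV.T4Continuum.B13OpDatumJunctions (opOf RawBounded WeightedEntrywiseRate)
open Summit.QuantumFields.BalabanUV.T4Continuum.B13OpMeasurable (measOp)
open Summit.QuantumFields.BalabanUV.T4Continuum.B13HistMeasurable (MeasPotFrame B13HistM)
open Summit.QuantumFields.BalabanUV.T4Continuum.B13StepTermLabels (TermIdx InnerLabel)
open Summit.QuantumFields.BalabanUV.T4Continuum.B13StepTermFamily (ActData ActExpLinearOn)
open Summit.QuantumFields.BalabanUV.T4Continuum.B13StepTermSocket (labelsIndexing)
open Summit.QuantumFields.BalabanUV.T4Continuum.B13InnerData (Bnd b13InnerData)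
open Summit.QuantumFields.BalabanUV.T4Continuum.UrsellTreeSum (ind)
open Summit.QuantumFields.BalabanUV.T4Continuum.UrsellTermBudget (actSum)
open Summit.QuantumFields.BalabanUV.T4Continuum.B13DomainGeometryTR (SCube footprint domainGeometry)
open Summit.QuantumFields.BalabanUV.T4Continuum.B13Base (selfCtr)
open Summit.QuantumFields.BalabanUV.T4Continuum.B13StepOfRecord (Slots assembly step outA outB)
open Summit.QuantumFields.BalabanUV.T4Continuum.B13StepOfRecordSub (assemblyOn restrict)
open Summit.QuantumFields.BalabanUV.T4Continuum.B13TermOpEnvelope (ActOpLineAnalyticOn)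
open Summit.QuantumFields.BalabanUV.T4Continuum.B13StepEnvelopeEndUniform (uniform_ne5_of_record_restrict_envelope)
open Summit.QuantumFields.BalabanUV.T4Continuum.B13StepEndInsOpBalaban (sqrt_rate_pos_lt_one c1_balaban_nonneg)
open Summit.QuantumFields.BalabanUV.T4Continuum.B13StepOfRecordSubstrateShiftLetters (opA_mem_measOp_slotsOfRecordShift opB_mem_measOp_slotsOfRecordShift
  transportReads_slotsOfRecordShift_of_factor)
open Summit.QuantumFields.BalabanUV.T4Continuum.B13ReadingsDecay (CovWeightDominatesDist)
open Summit.QuantumFields.BalabanUV.T4Continuum.B13ReadingsLevelWindow (ReadsTowerCovAOn ReadsTowerCovBOn)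
open Summit.QuantumFields.BalabanUV.T4Continuum.B13ReadingsImage
open Summit.QuantumFields.BalabanUV.T4Continuum.B13ReadingsLocal (PotQLipschitzReading PotRLipschitzReading)
open Summit.QuantumFields.BalabanUV.T4Continuum.B13ReadingsAssembly (CpertRec)
open Summit.QuantumFields.BalabanUV.T4Continuum.SubstrateO1ReadingsShift (weightedEntrywiseRate_slotsOfRecordShift_balaban_ne3Shape)
open Summit.QuantumFields.BalabanUV.T4Continuum.DecayRateInterpolation (EntryDecay)
open Summit.QuantumFields.BalabanUV.T4Continuum.SubstrateBackgroundTransporters (unitMod)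
open Summit.QuantumFields.BalabanUV.T4Continuum.SubstrateTwoRunsDriven (DrivenRuns)
open Summit.QuantumFields.BalabanUV.T4Continuum.SubstrateRawSpecies (rawAOfRecord)
open Summit.QuantumFields.BalabanUV.T4Continuum.SubstrateSlotsOfRecord (SpeciesRec SlotLetters slotsOfRecord)
open Summit.QuantumFields.BalabanUV.T4Continuum.SubstrateSlotsOfRecordShift (rawBOfRecordShift slotsOfRecordShift)
open Summit.QuantumFields.BalabanUV.T4Continuum.BalabanAveragedTowerUnit (idx)
open Summit.QuantumFields.BalabanUV.T4Continuum.GaugeTermScalarData (QuT Q1)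
open Summit.QuantumFields.BalabanUV.T4Continuum.RegularSiteTransporters (siteT)
open Summit.QuantumFields.BalabanUV.T4Continuum.RegularBackgroundTower (RegularTransporters)
open Summit.QuantumFields.BalabanUV.T4Continuum.NE2ColourPerturbedLayer (pertCovC)
open Summit.QuantumFields.BalabanUV.T4Continuum.NE2BalabanRoot (balabanPert)
open Summit.QuantumFields.BalabanUV.T4Continuum.NE2BalabanGauge (gaugeSlot liftR)
open Summit.QuantumFields.BalabanUV.T4Continuum.NE2BalabanThreshold (etaStar)
open Summit.QuantumFields.BalabanUV.T4Continuum.NE2FromNE3Carrier (ne2Loc)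
open Summit.QuantumFields.BalabanUV.T4Continuum.MinimalActionRate (minActReadings)

/-! ## One constant for every driven two-run object and every letter package (η-uniformity at the substrate's cov-shifted instance) -/

section Uniform

variable {d : ℕ} (L : ℕ) [NeZero L] (M : Fin d → ℕ) [hM : ∀ μ, NeZero (M μ)] (a : ℝ) (ha : 0 < a)
variable {o : Type*} [Fintype o] [DecidableEq o] {α β C a' η θ : ℝ} {m : Type*} [Fintype m] [DecidableEq m]

/-- [folklore] **ONE CONSTANT FOR EVERY DRIVEN TWO-RUN OBJECT AND EVERY LETTER PACKAGE (η-UNIFORMITY AT THE SUBSTRATE's COV-SHIFTED O1 INSTANCE),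
W1 PRODUCED AT BAŁABAN's TIER-B BACKGROUND, LETTERS ELIMINATED** — this lineage's `B13StepEnvelopeEndUniform.uniform_ne5_of_record_restrict_envelope`
(p218872; entry type quantified INSIDE `∃ C₅`) with `c₁ :=` W1's assembled constant and `θ := √(max θ L⁻¹)` (both SIZES), its `hwer` binder supplied per
two-run object and letter package by substrate-p1's W-21b `weightedEntrywiseRate_slotsOfRecordShift_balaban_ne3Shape` (run B's covariance ONE LEVEL DEEPER,
WINDOWED tower readings `ReadsTowerCovAOn {k : ℕ | k ≤ D.K}` ∕ `ReadsTowerCovBOn …` (owner R55 (R-i), g37-c `B13ReadingsLevelWindow`)), its sub-slot `M := measOp …` with memberships from the six letter conditions at the shift, its `hT` by the factorisation datum.  Fix the SIZES (`κ, Φ′,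
EA₀, E₀, cA, cB, r₀, δ′, θ′, ω`, the letters of W1's constant `o, d, L, a, α, β, C, a′, B₁, B₂, B₃, Λ₂, …, Λ₅`, U1b's `θ < 1`), subject to `√(max θ L⁻¹) ≤
θ′ ≤ 1`, `0 ≤ Φ′`, `36Φ′ < 1` and the TWO STRICT SIZE INEQUALITIES.  Then ONE `C₅` serves EVERY gauge group `𝔾`, driven two-run object `D : DrivenRuns 𝔾`,
representation `ιr`, letters `cc ag sg`, frame `Pm`, insertion-operator sort `IOp`, factor index data `𝒵 domZ Jc Vv mI`, EVERY letter package `Lsl` with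
`Lsl.ins.ω = ω` satisfying the six letter conditions at the shift, factorisation datum `(iopAt, hiopA)`, measurable sort `Ω′`, admissible data `dom ∕ 𝒞 ∕ N
∕ RgV` in the (3.35)-class and in U1b's shape `NE3Shape … C θ`, towers over `D`'s run-B backgrounds, O1 letters at the substrate's shifted tables, window,
roomy class, majorants `A ∕ A′` with decay split and anchored norm `Φ′`, W2 data `ActOpLineAnalyticOn` ∕ `ActExpLinearOn` over `↥measOp`: the displayed
binders IMPLY `NE5 (B13StepOfRecord.outA (slotsOfRecordShift …) E₀ cB) (B13StepOfRecord.outB (slotsOfRecordShift …) E₀ cB) W κ θ′ C₅`.  NOT a proof of NE5 ∕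
NE2 ∕ NE3: an implication from displayed binders, the quantifier order `∃ C₅, ∀ 𝔾 D … Lsl …` being the point. -/
theorem uniform_ne5_of_substrateShift_restrict_envelope_balaban_ne3Shape (hL : 2 ≤ L) (hd : 1 ≤ d) (hα : 0 ≤ α) (hβ : 0 ≤ β) (hC : 0 ≤ C)
    (ha' : 0 < a') (hαη : α ≤ η) (hβη : β ≤ η) (hη : η ≤ etaStar o d a a') {B₁ B₂ B₃ Λ₂ Λ₃ Λ₄ Λ₅ : ℝ} (hΛ₂ : 0 ≤ Λ₂) (hΛ₃ : 0 ≤ Λ₃)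
    (hΛ₄ : 0 ≤ Λ₄) (hΛ₅ : 0 ≤ Λ₅) (hθ1 : θ < 1) {κ Φ' EA₀ E₀ cA cB r₀ δ' θ' ω : ℝ}
    (hE₀ : 0 ≤ E₀) (hκ : 0 ≤ κ) (hΦ0 : 0 ≤ Φ') (hΦsmall : 36 * Φ' < 1) (hcA : 0 ≤ cA) (hcB : 0 ≤ cB) (hr₀ : 0 < r₀) (hδ' : 0 ≤ δ')
    (hθθ' : Real.sqrt (max θ ((L : ℝ)⁻¹)) ≤ θ') (hθ'1 : θ' ≤ 1) (hω : 0 < ω) (hω1 : ω < 1)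
    (hh : cA * (EA₀ + E₀) < 1 - ω) (hsmall : ω + Φ' / (1 - 36 * Φ') * cA * (1 - ω) / (1 - ω - cA * (EA₀ + E₀)) < θ') :
    ∃ C₅ : ℝ, ∀ {𝔾 : Type} [GaugeGroup 𝔾] (D : DrivenRuns 𝔾) {oc : Type} [Fintype oc] [DecidableEq oc] (ιr : 𝔾 →* Matrix oc oc ℂ) (cc : ℂ)
      (ag : ℝ) (sg : ℕ → ℂ) {T ι' Sy Ω 𝒴 : Type} [MeasurableSpace Ω] (Pm : MeasPotFrame D.carriers) {IOp : Type*}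
      (𝒵 : D.carriers.Dom → InnerLabel D.carriers.Dom (Bnd D.toTwoRuns) → Type) [∀ Z j, Fintype (𝒵 Z j)]
      (domZ : ∀ Z j, 𝒵 Z j → D.carriers.Dom) (Jc : D.carriers.Dom → InnerLabel D.carriers.Dom (Bnd D.toTwoRuns) → Type)
      [∀ Z j, Fintype (Jc Z j)] (Vv : D.carriers.Dom → InnerLabel D.carriers.Dom (Bnd D.toTwoRuns) → Type)
      [∀ Z j, NormedAddCommGroup (Vv Z j)] [∀ Z j, InnerProductSpace ℝ (Vv Z j)] [∀ Z j, MeasurableSpace (Vv Z j)] [∀ Z j, BorelSpace (Vv Z j)]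
      [∀ Z j, FiniteDimensional ℝ (Vv Z j)] (mI : D.carriers.Dom → InnerLabel D.carriers.Dom (Bnd D.toTwoRuns) → Type)
      [∀ Z j, Fintype (mI Z j)] [∀ Z j, DecidableEq (mI Z j)]
      (Lsl : SlotLetters D (o := oc) (T := T) (ι' := ι') (S := Sy) (Ω := Ω) (𝒴 := 𝒴) Pm (IOp := IOp) 𝒵 domZ Jc Vv mI)
      (hbdA : ∀ (g : ℕ → ℝ) (U : D.carriers.BgA) (k : ℕ),
        FormatBounded (Lsl.W k).format (rawAOfRecord ιr D cc ag sg Lsl.ΓA Lsl.dkA Lsl.gcA Lsl.pQA Lsl.pRA g U k).kernel)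
      (hmQA : ∀ (r : ℝ) (U : GaugeField (D.F.P D.K) 0 𝔾) (k : ℕ) (Y : 𝒴) (b b' : ((Tor (unitMod (D.F.P D.K)) × Fin (D.F.P D.K).d) × oc)),
          Measurable fun x : Ω => Lsl.pQA r U k x Y b b')
      (hmRA : ∀ (r : ℝ) (U : GaugeField (D.F.P D.K) 0 𝔾) (k : ℕ) (Y : 𝒴), Measurable fun x : Ω => Lsl.pRA r U k x Y)
      (hbdB : ∀ (g : ℕ → ℝ) (U : D.carriers.BgB) (k : ℕ),
        FormatBounded (Lsl.W k).format (rawBOfRecordShift D ιr cc ag sg Lsl.ΓB Lsl.dkB Lsl.gcB Lsl.pQB Lsl.pRB g U k).kernel)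
      (hmQB : ∀ (r : ℝ) (U : GaugeField (D.F.P (D.K + 1)) 0 𝔾) (k : ℕ) (Y : 𝒴) (b b' : ((Tor (unitMod (D.F.P D.K)) × Fin (D.F.P D.K).d) × oc)),
          Measurable fun x : Ω => Lsl.pQB r U k x Y b b')
      (hmRB : ∀ (r : ℝ) (U : GaugeField (D.F.P (D.K + 1)) 0 𝔾) (k : ℕ) (Y : 𝒴), Measurable fun x : Ω => Lsl.pRB r U k x Y)
      (iopAt : ℝ → D.carriers.BgA → ℕ → IOp)
      {𝒞 : ℕ → Set (B7Prop1Explicit.Site d → Fin d → (Matrix o o ℂ)ˣ)} {N : ℕ}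
      {dom : Set (B7Prop1Explicit.Site d → Fin d → (Matrix o o ℂ)ˣ)}
      {RgV : (B7Prop1Explicit.Site d → Fin d → (Matrix o o ℂ)ˣ) → ((k : ℕ) → Fin d → (Tor (fine (lev L k) M) → Matrix o o ℂ))}
      {tow : ℕ → (ℕ → ℝ) → D.toTwoRuns.carriers.BgB → ↥dom} {W : Set (ℕ → ℝ)}
      {σ : T → ((Tor (unitMod (D.F.P D.K)) × Fin (D.F.P D.K).d) × oc) → idx L M 0 × o} {dist₁ : idx L M 0 × o → idx L M 0 × o → ℝ} {δ₁ : ℝ}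
      {S₂ : Set (Matrix (idx L M 0 × o) (idx L M 0 × o) ℂ)} {Φ : T → Matrix (idx L M 0 × o) (idx L M 0 × o) ℂ → Matrix m m ℂ}
      {dist₂ : m → m → ℝ} {δ₂ : ℝ} {σX : T → ι' → m}
      {S₃ : Set (Matrix (idx L M 0 × o) (idx L M 0 × o) ℂ)} {Ψ : T → Matrix (idx L M 0 × o) (idx L M 0 × o) ℂ → Matrix m m ℂ}
      {dist₃ : m → m → ℝ} {δ₃ : ℝ} {σB : T → ((Tor (unitMod (D.F.P D.K)) × Fin (D.F.P D.K).d) × oc) → m}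
      {Ω' : Type*} [MeasurableSpace Ω'] {ROp RHist : ℕ → ℝ}
      {A A' : ℕ → (ℕ → ℝ) → D.toTwoRuns.carriers.BgB → D.toTwoRuns.carriers.Dom → InnerLabel D.toTwoRuns.carriers.Dom (Bnd D.toTwoRuns) → ℝ}
      {Dt : ActData D.toTwoRuns.carriers.Dom (InnerLabel D.toTwoRuns.carriers.Dom (Bnd D.toTwoRuns))
        (measOp T ((Tor (unitMod (D.F.P D.K)) × Fin (D.F.P D.K).d) × oc) ι' Ω 𝒴) (B13HistM Pm) Ω'},
      Lsl.ins.ω = ω →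
      (∀ (r : ℝ) (U : D.carriers.BgB) (k : ℕ), Lsl.ins.iopA r U k = iopAt r (D.carriers.transport U) k) →
      (∀ V ∈ dom, RegularTransporters L M (liftR L M (RgV V)) α β) →
      NE3Shape (minActReadings d 𝒞 L N dom (ne2Loc L M fun V => liftR L M (RgV V))) C θ →
      (∀ V ∈ dom, ∀ k, EntryDecay dist₁
        (pertCovC L M a ha (balabanPert L M a (liftR L M (RgV V)) (gaugeSlot L M (RgV V) (QuT L M o (siteT L M (RgV V))) (Q1 L M o) a'))
          1 k) B₁ δ₁) →
      ReadsTowerCovAOn {k : ℕ | k ≤ D.K}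
        (fun V : ↥dom => pertCovC L M a ha
          (balabanPert L M a (liftR L M (RgV V)) (gaugeSlot L M (RgV V) (QuT L M o (siteT L M (RgV V))) (Q1 L M o) a')) 1)
        σ tow (fun g U k => (rawAOfRecord ιr D cc ag sg Lsl.ΓA Lsl.dkA Lsl.gcA Lsl.pQA Lsl.pRA) g (D.toTwoRuns.carriers.transport U) k) W →
      ReadsTowerCovBOn {k : ℕ | k ≤ D.K}
        (fun V : ↥dom => pertCovC L M a ha
          (balabanPert L M a (liftR L M (RgV V)) (gaugeSlot L M (RgV V) (QuT L M o (siteT L M (RgV V))) (Q1 L M o) a')) 1)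
        σ tow (rawBOfRecordShift D ιr cc ag sg Lsl.ΓB Lsl.dkB Lsl.gcB Lsl.pQB Lsl.pRB) W →
      CovWeightDominatesDist (slotsOfRecordShift D ιr cc ag sg Pm 𝒵 domZ Jc Vv mI Lsl).F dist₁ σ (δ₁ / 2) →
      (∀ t, OpLipschitzOn S₂ (Φ t) Λ₂) →
      (∀ V ∈ dom, ∀ k, pertCovC L M a ha
        (balabanPert L M a (liftR L M (RgV V)) (gaugeSlot L M (RgV V) (QuT L M o (siteT L M (RgV V))) (Q1 L M o) a')) 1 k ∈ S₂) →
      (∀ V ∈ dom, ∀ t k, EntryDecay dist₂ (Φ t (pertCovC L M a ha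
        (balabanPert L M a (liftR L M (RgV V)) (gaugeSlot L M (RgV V) (QuT L M o (siteT L M (RgV V))) (Q1 L M o) a')) 1 k)) B₂ δ₂) →
      ReadsTowerDeltaA (fun (V : ↥dom) t k => Φ t (pertCovC L M a ha
        (balabanPert L M a (liftR L M (RgV V)) (gaugeSlot L M (RgV V) (QuT L M o (siteT L M (RgV V))) (Q1 L M o) a')) 1 k))
        σX tow (fun g U k => (rawAOfRecord ιr D cc ag sg Lsl.ΓA Lsl.dkA Lsl.gcA Lsl.pQA Lsl.pRA) g (D.toTwoRuns.carriers.transport U) k) W →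
      ReadsTowerDeltaB (fun (V : ↥dom) t k => Φ t (pertCovC L M a ha
        (balabanPert L M a (liftR L M (RgV V)) (gaugeSlot L M (RgV V) (QuT L M o (siteT L M (RgV V))) (Q1 L M o) a')) 1 k))
        σX tow (rawBOfRecordShift D ιr cc ag sg Lsl.ΓB Lsl.dkB Lsl.gcB Lsl.pQB Lsl.pRB) W →
      DeltaWeightDominatesDist (slotsOfRecordShift D ιr cc ag sg Pm 𝒵 domZ Jc Vv mI Lsl).F dist₂ σX (δ₂ / 2) →
      (∀ t, OpLipschitzOn S₃ (Ψ t) Λ₃) →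
      (∀ V ∈ dom, ∀ k, pertCovC L M a ha
        (balabanPert L M a (liftR L M (RgV V)) (gaugeSlot L M (RgV V) (QuT L M o (siteT L M (RgV V))) (Q1 L M o) a')) 1 k ∈ S₃) →
      (∀ V ∈ dom, ∀ t k, EntryDecay dist₃ (Ψ t (pertCovC L M a ha
        (balabanPert L M a (liftR L M (RgV V)) (gaugeSlot L M (RgV V) (QuT L M o (siteT L M (RgV V))) (Q1 L M o) a')) 1 k)) B₃ δ₃) →
      ReadsTowerGammaA (fun (V : ↥dom) t k => Ψ t (pertCovC L M a ha
        (balabanPert L M a (liftR L M (RgV V)) (gaugeSlot L M (RgV V) (QuT L M o (siteT L M (RgV V))) (Q1 L M o) a')) 1 k))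
        σB σX tow (fun g U k => (rawAOfRecord ιr D cc ag sg Lsl.ΓA Lsl.dkA Lsl.gcA Lsl.pQA Lsl.pRA) g (D.toTwoRuns.carriers.transport U) k) W →
      ReadsTowerGammaB (fun (V : ↥dom) t k => Ψ t (pertCovC L M a ha
        (balabanPert L M a (liftR L M (RgV V)) (gaugeSlot L M (RgV V) (QuT L M o (siteT L M (RgV V))) (Q1 L M o) a')) 1 k))
        σB σX tow (rawBOfRecordShift D ιr cc ag sg Lsl.ΓB Lsl.dkB Lsl.gcB Lsl.pQB Lsl.pRB) W →
      GammaWeightDominatesDist (slotsOfRecordShift D ιr cc ag sg Pm 𝒵 domZ Jc Vv mI Lsl).F dist₃ σB σX (δ₃ / 2) →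
      PotQLipschitzReading (minActReadings d 𝒞 L N dom (ne2Loc L M fun V => liftR L M (RgV V))) (slotsOfRecordShift D ιr cc ag sg Pm 𝒵 domZ Jc Vv mI Lsl).F
        (fun g U k => (rawAOfRecord ιr D cc ag sg Lsl.ΓA Lsl.dkA Lsl.gcA Lsl.pQA Lsl.pRA) g (D.toTwoRuns.carriers.transport U) k)
        (rawBOfRecordShift D ιr cc ag sg Lsl.ΓB Lsl.dkB Lsl.gcB Lsl.pQB Lsl.pRB) W Λ₄ →
      PotRLipschitzReading (minActReadings d 𝒞 L N dom (ne2Loc L M fun V => liftR L M (RgV V))) (slotsOfRecordShift D ιr cc ag sg Pm 𝒵 domZ Jc Vv mI Lsl).F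
        (fun g U k => (rawAOfRecord ιr D cc ag sg Lsl.ΓA Lsl.dkA Lsl.gcA Lsl.pQA Lsl.pRA) g (D.toTwoRuns.carriers.transport U) k)
        (rawBOfRecordShift D ιr cc ag sg Lsl.ΓB Lsl.dkB Lsl.gcB Lsl.pQB Lsl.pRB) W Λ₅ →
      (assembly (slotsOfRecordShift D ιr cc ag sg Pm 𝒵 domZ Jc Vv mI Lsl)).SliceBudgetB W κ cB →
      (slotsOfRecordShift D ιr cc ag sg Pm 𝒵 domZ Jc Vv mI Lsl).D.SliceBudget (step (slotsOfRecordShift D ιr cc ag sg Pm 𝒵 domZ Jc Vv mI Lsl) E₀ cB) W κ cA →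
      DecayBound (B13StepOfRecord.outA (slotsOfRecordShift D ιr cc ag sg Pm 𝒵 domZ Jc Vv mI Lsl) E₀ cB) W EA₀ κ →
      DecayBound (B13StepOfRecord.outB (slotsOfRecordShift D ιr cc ag sg Pm 𝒵 domZ Jc Vv mI Lsl) E₀ cB) W E₀ κ →
      RawBounded (slotsOfRecordShift D ιr cc ag sg Pm 𝒵 domZ Jc Vv mI Lsl).F (assembly (slotsOfRecordShift D ιr cc ag sg Pm 𝒵 domZ Jc Vv mI Lsl)).rawAt W →
      RawBounded (slotsOfRecordShift D ιr cc ag sg Pm 𝒵 domZ Jc Vv mI Lsl).F (slotsOfRecordShift D ιr cc ag sg Pm 𝒵 domZ Jc Vv mI Lsl).rawB W →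
      (∀ k, r₀ ≤ Lsl.rOp k) →
      (step (slotsOfRecordShift D ιr cc ag sg Pm 𝒵 domZ Jc Vv mI Lsl) E₀ cB).InsertionRate W κ E₀ δ' (Real.sqrt (max θ ((L : ℝ)⁻¹))) →
      (∀ k, Lsl.rOp k ≤ ROp k) → (∀ k, (assembly (slotsOfRecordShift D ιr cc ag sg Pm 𝒵 domZ Jc Vv mI Lsl)).bHist E₀ cB k + Lsl.rHist k ≤ RHist k) →
      (∀ k, ∀ g ∈ W, ∀ (U : D.toTwoRuns.carriers.BgB) (q : (measOp T ((Tor (unitMod (D.F.P D.K)) × Fin (D.F.P D.K).d) × oc) ι' Ω 𝒴) × B13HistM Pm),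
        q ∈ (ballClass (selfCtr (assemblyOn (restrict (slotsOfRecordShift D ιr cc ag sg Pm 𝒵 domZ Jc Vv mI Lsl) (measOp T ((Tor (unitMod (D.F.P D.K)) × Fin (D.F.P D.K).d) × oc) ι' Ω 𝒴)
            (opA_mem_measOp_slotsOfRecordShift D ιr cc ag sg Pm 𝒵 domZ Jc Vv mI Lsl hbdA hmQA hmRA)
            (opB_mem_measOp_slotsOfRecordShift D ιr cc ag sg Pm 𝒵 domZ Jc Vv mI Lsl hbdB hmQB hmRB))).raw
          (assemblyOn (restrict (slotsOfRecordShift D ιr cc ag sg Pm 𝒵 domZ Jc Vv mI Lsl) (measOp T ((Tor (unitMod (D.F.P D.K)) × Fin (D.F.P D.K).d) × oc) ι' Ω 𝒴)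
            (opA_mem_measOp_slotsOfRecordShift D ιr cc ag sg Pm 𝒵 domZ Jc Vv mI Lsl hbdA hmQA hmRA)
            (opB_mem_measOp_slotsOfRecordShift D ιr cc ag sg Pm 𝒵 domZ Jc Vv mI Lsl hbdB hmQB hmRB))).histRef) ROp RHist) k g U →
          ∀ X : D.toTwoRuns.carriers.Dom, D.toTwoRuns.carriers.scale X = k → ∀ i : TermIdx D.toTwoRuns.carriers.Dom (Bnd D.toTwoRuns),
            (labelsIndexing (domainGeometry D.toTwoRuns) (b13InnerData D.toTwoRuns)).Rel k i X → ∀ m,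
              ‖(slotsOfRecordShift D ιr cc ag sg Pm 𝒵 domZ Jc Vv mI Lsl).act ((labelsIndexing (domainGeometry D.toTwoRuns) (b13InnerData D.toTwoRuns)).poly i m)
                  ((labelsIndexing (domainGeometry D.toTwoRuns) (b13InnerData D.toTwoRuns)).lab i m) (q.1 : OpDatum (SpeciesRec D oc T ι' Ω 𝒴)) q.2‖ ≤
                A k g U ((labelsIndexing (domainGeometry D.toTwoRuns) (b13InnerData D.toTwoRuns)).poly i m) ((labelsIndexing (domainGeometry D.toTwoRuns) (b13InnerData D.toTwoRuns)).lab i m)) →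
      (∀ k g U Z ℓ, 0 ≤ A k g U Z ℓ) → (∀ k g U Z ℓ, 0 ≤ A' k g U Z ℓ) →
      (∀ k g U Z ℓ, A k g U Z ℓ ≤ A' k g U Z ℓ * Real.exp (-(κ * (D.toTwoRuns.carriers.d Z + 5)))) →
      (∀ k, ∀ g ∈ W, ∀ (U : D.toTwoRuns.carriers.BgB) (q : SCube D.toTwoRuns),
        ∑ Z ∈ D.toTwoRuns.domAt k, ind (q ∈ footprint Z) * actSum (b13InnerData D.toTwoRuns) (A' k g U) k Z *
          Real.exp ((footprint Z).card) ≤ Φ') →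
      ActOpLineAnalyticOn (labelsIndexing (domainGeometry D.toTwoRuns) (b13InnerData D.toTwoRuns))
        (restrict (slotsOfRecordShift D ιr cc ag sg Pm 𝒵 domZ Jc Vv mI Lsl) (measOp T ((Tor (unitMod (D.F.P D.K)) × Fin (D.F.P D.K).d) × oc) ι' Ω 𝒴)
          (opA_mem_measOp_slotsOfRecordShift D ιr cc ag sg Pm 𝒵 domZ Jc Vv mI Lsl hbdA hmQA hmRA)
          (opB_mem_measOp_slotsOfRecordShift D ιr cc ag sg Pm 𝒵 domZ Jc Vv mI Lsl hbdB hmQB hmRB)).act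
        (ballClass (selfCtr (assemblyOn (restrict (slotsOfRecordShift D ιr cc ag sg Pm 𝒵 domZ Jc Vv mI Lsl) (measOp T ((Tor (unitMod (D.F.P D.K)) × Fin (D.F.P D.K).d) × oc) ι' Ω 𝒴)
            (opA_mem_measOp_slotsOfRecordShift D ιr cc ag sg Pm 𝒵 domZ Jc Vv mI Lsl hbdA hmQA hmRA)
            (opB_mem_measOp_slotsOfRecordShift D ιr cc ag sg Pm 𝒵 domZ Jc Vv mI Lsl hbdB hmQB hmRB))).raw
          (assemblyOn (restrict (slotsOfRecordShift D ιr cc ag sg Pm 𝒵 domZ Jc Vv mI Lsl) (measOp T ((Tor (unitMod (D.F.P D.K)) × Fin (D.F.P D.K).d) × oc) ι' Ω 𝒴)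
            (opA_mem_measOp_slotsOfRecordShift D ιr cc ag sg Pm 𝒵 domZ Jc Vv mI Lsl hbdA hmQA hmRA)
            (opB_mem_measOp_slotsOfRecordShift D ιr cc ag sg Pm 𝒵 domZ Jc Vv mI Lsl hbdB hmQB hmRB))).histRef) ROp RHist) W →
      ActExpLinearOn (labelsIndexing (domainGeometry D.toTwoRuns) (b13InnerData D.toTwoRuns))
        (restrict (slotsOfRecordShift D ιr cc ag sg Pm 𝒵 domZ Jc Vv mI Lsl) (measOp T ((Tor (unitMod (D.F.P D.K)) × Fin (D.F.P D.K).d) × oc) ι' Ω 𝒴)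
          (opA_mem_measOp_slotsOfRecordShift D ιr cc ag sg Pm 𝒵 domZ Jc Vv mI Lsl hbdA hmQA hmRA)
          (opB_mem_measOp_slotsOfRecordShift D ιr cc ag sg Pm 𝒵 domZ Jc Vv mI Lsl hbdB hmQB hmRB)).act Dt
        (ballClass (selfCtr (assemblyOn (restrict (slotsOfRecordShift D ιr cc ag sg Pm 𝒵 domZ Jc Vv mI Lsl) (measOp T ((Tor (unitMod (D.F.P D.K)) × Fin (D.F.P D.K).d) × oc) ι' Ω 𝒴)
            (opA_mem_measOp_slotsOfRecordShift D ιr cc ag sg Pm 𝒵 domZ Jc Vv mI Lsl hbdA hmQA hmRA)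
            (opB_mem_measOp_slotsOfRecordShift D ιr cc ag sg Pm 𝒵 domZ Jc Vv mI Lsl hbdB hmQB hmRB))).raw
          (assemblyOn (restrict (slotsOfRecordShift D ιr cc ag sg Pm 𝒵 domZ Jc Vv mI Lsl) (measOp T ((Tor (unitMod (D.F.P D.K)) × Fin (D.F.P D.K).d) × oc) ι' Ω 𝒴)
            (opA_mem_measOp_slotsOfRecordShift D ιr cc ag sg Pm 𝒵 domZ Jc Vv mI Lsl hbdA hmQA hmRA)
            (opB_mem_measOp_slotsOfRecordShift D ιr cc ag sg Pm 𝒵 domZ Jc Vv mI Lsl hbdB hmQB hmRB))).histRef) ROp RHist) W →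
      NE5 (B13StepOfRecord.outA (slotsOfRecordShift D ιr cc ag sg Pm 𝒵 domZ Jc Vv mI Lsl) E₀ cB) (B13StepOfRecord.outB (slotsOfRecordShift D ιr cc ag sg Pm 𝒵 domZ Jc Vv mI Lsl) E₀ cB) W κ θ' C₅ := by
  obtain ⟨hΘ0, hΘ1⟩ := sqrt_rate_pos_lt_one L hL hθ1
  obtain ⟨C₅, hC₅⟩ := uniform_ne5_of_record_restrict_envelope (κ := κ) (Φ' := Φ')
    (c₁ := Real.sqrt (2 * B₁ * (2 * CpertRec o d L a α β C a' / (1 - max θ ((L : ℝ)⁻¹)))) +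
      Real.sqrt (2 * B₂ * (Λ₂ * CpertRec o d L a α β C a')) + Real.sqrt (2 * B₃ * (Λ₃ * CpertRec o d L a α β C a')) +
      Λ₄ * C + Λ₅ * C)
    hE₀ hκ hΦ0 hΦsmall hcA hcB (c1_balaban_nonneg L a hC hΛ₄ hΛ₅) hr₀ hδ' hΘ0 hΘ1 hθθ' hθ'1 hω hω1 hh hsmall
  refine ⟨C₅, ?_⟩
  intro 𝔾 _ D oc _ _ ιr cc ag sg T ι' Sy Ω 𝒴 _ Pm IOp 𝒵 _ domZ Jc _ Vv _ _ _ _ _ mI _ _ Lsl hbdA hmQA hmRA hbdB hmQB hmRB iopAt 𝒞 N dom RgV tow W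
    σ dist₁ δ₁ S₂ Φ dist₂ δ₂ σX S₃ Ψ dist₃ δ₃ σB Ω' _ ROp RHist A A' Dt hLω hiopA hreg hNE3 hdec₁ hcovA hcovB hdom₁ hΦ hS₂ hdecΦ hΔA hΔB hdom₂ hΨ
    hS₃ hdecΨ hΓA hΓB hdom₃ hQ hR hbB hbA hdA hdB hRA hRB hfl hins hOp hHist hA hA0 hA0' hdec hΦ' hact hexp
  have hwer := weightedEntrywiseRate_slotsOfRecordShift_balaban_ne3Shape D ιr cc ag sg Pm 𝒵 domZ Jc Vv mI Lsl L M a ha hL hd hreg hα hβ hC hNE3 ha'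
    hαη hβη hη hdec₁ hcovA hcovB hdom₁ hΦ hΛ₂ hS₂ hdecΦ hΔA hΔB hdom₂ hΨ hΛ₃ hS₃ hdecΨ hΓA hΓB hdom₃ hΛ₄ hΛ₅ hQ hR
  exact hC₅ (slotsOfRecordShift D ιr cc ag sg Pm 𝒵 domZ Jc Vv mI Lsl) (measOp T ((Tor (unitMod (D.F.P D.K)) × Fin (D.F.P D.K).d) × oc) ι' Ω 𝒴)
    (opA_mem_measOp_slotsOfRecordShift D ιr cc ag sg Pm 𝒵 domZ Jc Vv mI Lsl hbdA hmQA hmRA)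
    (opB_mem_measOp_slotsOfRecordShift D ιr cc ag sg Pm 𝒵 domZ Jc Vv mI Lsl hbdB hmQB hmRB) hLω
    (transportReads_slotsOfRecordShift_of_factor D ιr cc ag sg Pm 𝒵 domZ Jc Vv mI Lsl iopAt hiopA W) hbB hbA hdA hdB hRA hRB hwer hfl hins hOp hHist
    hA hA0 hA0' hdec hΦ' hact hexp

end Uniform

end Summit.QuantumFields.BalabanUV.T4Continuum.B13StepEnvelopeEndSubstrateShiftBalabanUniform

end
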